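import Summits.BirchSwinnertonDyer.Rank1Residual.Additive.X3RankZeroLowerCertificate
import Summits.BirchSwinnertonDyer.Rank1Residual.Additive.N10IsogenyTransport
import Summits.BirchSwinnertonDyer.Rank1Residual.Additive.N10LowerHalfResidue
import Literature.NumberTheory.EllipticCurves.Wuthrich2014.ReducibleDivisibilityCyclotomicPrimeComponentOfHalf
import HarnessLib

/-!
# X3 / N10 on the semistable-twist locus, rank `0`: the residue chain and the N10 class ENDs over ONE
# typed reading of Wuthrich 2014 Thm. 16 — the component reading `hWu` OUT, nothing added
# (cell `b2b-bsdres`, team n1011, ROW T-WU16X, seat p10 GEN 10; hygiene sequel in the sense of referee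
# rulings R118.3 / R119.2 and of n1011-p12's `Additive/X3BranchLowerEndStateThm16.lean`)

HONEST FRAMING (cell `b2b-bsdres`, run/shared/lean/b2b/bsd-rank1-residual/, verbatim in every
file): the goal of the cell is to DELETE the COMBINATION-SHAPED residual classes of the
Birch–Swinnerton-Dyer formula for ALL analytic-rank `≤ 1` elliptic curves over `ℚ` — "full BSD
formula for every rank `≤ 1` curve in class `C`" assembled STRICTLY from published theorems — so
that the rank-`≤ 1` remainder becomes exactly the CONSTRUCTION-SHAPED classes, which are TYPED
(missing-input `Prop`s), NOT attempted. This is not "finishing BSD". Team n1011 (RESIDUAL-MAP §I N10: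
X3 = additive `p`, `E[p]` REDUCIBLE, rank `0`): research route; END-twin theorems only — no definition,
no named fact, no `sorry`; nothing booked; no residual-map mark / label / count moved; X3♯ and N10 stay
CONSTRUCTION-SHAPED. NOTHING of additive-p4's (`X3SharpResidue`, `X3RankZeroLowerCertificate`) or
cc-typer-2's (`N10IsogenyTransport`, `N10LowerHalfResidue`) is edited: every declaration below is NEW
and consumes theirs BY NAME.

## What and why

additive-p4's X3♯ residue chain `ClassX3.…_rankZero_of_subSemistableTwist…` (every odd `p`, (M) ∪
(G-ord, `e = 2`)) and its consumers — cc-typer-2's N10 CLASS END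
`N10.bsdp_rankZero_classX3_of_lowerHalf_of_subSemistableTwist` and the N10 isogeny transports — DISPLAY
Wuthrich 2014 Thm. 16 through TWO typed readings at once: the general half-eigenspace reading
`hW16 : Wuthrich2014.thm16_halfEigenCharIdeal_dvd_cyclotomicPrime` (A134; used on the (M) branch) and
the good-ordinary component reading `hWu : Wuthrich2014.charIdeal_dvd_padicLFunctionBranch_component`
(A125; used on the (G-ord) branch). The second is a KERNEL CONSEQUENCE of the first —
`Wuthrich2014.charIdeal_dvd_padicLFunctionBranch_component_of_half : A134 → A125`
(`Literature/…/Wuthrich2014/ReducibleDivisibilityCyclotomicPrimeComponentOfHalf.lean`, "kernel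
consistency check between two transcriptions of the same sentence", 0 hypotheses). This file re-states
the chain and its N10 consumers over `hW16` ALONE (binder diff EXACTLY {`hWu`} ↦ ∅, NOTHING added,
conclusions and every other binder identical; each proof = the original fed with
`charIdeal_dvd_padicLFunctionBranch_component_of_half hW16`), exactly as n1011-p12 did for the X3♯(G-ord)
branch-conjecture ENDs (`…_of_thm16`, referee rulings R118.3 / R119.2 "new consumers take the general
fact"):

* `ClassX3.missingUpperBoundAt_rankZero_of_subSemistableTwist_of_thm16`,
  `ClassX3.missingPPartAt_iff_lower_rankZero_of_subSemistableTwist_of_thm16`,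
  `ClassX3.bsdp_rankZero_of_subSemistableTwist_of_shaAn_unit_of_thm16` (r2 §II.23's X3 @ 3 W = 0 rows),
  `ClassX3.bsdp_rankZero_of_subSemistableTwist_of_lower_of_thm16` — named facts 6 ↦ 5 =
  {hDel, hGZK, hmod, hmodD, hW16};
* `ClassX3.bsdp_rankZero_of_subSemistableTwist_of_casselsTate_of_pow_dvd_of_thm16`,
  `ClassX3.bsdp_rankZero_of_subSemistableTwist_of_casselsTate_of_selmerGroup_ne_bot_of_thm16` (r2
  §II.23's X3 @ 3 W = 2 END of record) — 7 ↦ 6 (+ Cassels–Tate `hCT`);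
* `N10.bsdp_rankZero_classX3_of_lowerHalf_of_subSemistableTwist_of_thm16` — cc-typer-2's N10 CLASS END
  (typed `h : N10.LowerHalf`): 6 ↦ 5; `N10.bsdp_rankZero_classX3_of_isIsogenous_shaAn_unit_of_thm16`,
  `N10.missingLowerBoundAt_rankZero_classX3_of_isIsogenous_shaAn_unit_of_thm16` (+ `hCassels`): 7 ↦ 6.

What is NOT claimed: no row is closed; A125 stays a registered reading and the input of every END that
displays it alone (the (G-ord) chains at `p ≥ 5`); nothing is booked. Axioms standard.

References: C. Wuthrich, Doc. Math. 19 (2014) 381–402, Thm. 16 and §5 (p. 397), §3 (p. 390), Cor. 18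
(p. 398) [Wuthrich2014]; D. Delbourgo, Compositio Math. 113 (1998) Prop. 4 (p. 144) [Delbourgo1998];
J. S. Milne, ADT (2006) Thm. I.7.3 [MilneADT2006]; R. L. Miller, LMS J. Comput. Math. 14 (2011) Def. 1.1
[Miller2011LMS]; cells/n1011/PLAN.md §K.2; names line cells/n1011/INBOX.md 2026-08-22T09:2xZ.
-/

noncomputable section

open scoped Classical

open WeierstrassCurve Literature.NumberTheory.EllipticCurves
  Literature.NumberTheory.EllipticCurves.ModularForms
  Literature.NumberTheory.EllipticCurves.Rank1Residual
  Literature.NumberTheory.EllipticCurves.Rank1Residual.Typed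

namespace Summit.BirchSwinnertonDyer.Rank1Residual.Additive

/-! ### §1 additive-p4's X3♯ residue chain over `hW16` alone -/

section Residue

variable (W : WeierstrassCurve ℚ) [W.IsElliptic] [W.IsGloballyMinimal] (p : ℕ) [hp : Fact p.Prime]

/-- **X3 ∧ `r_an = 0` ∧ semistable twist, every odd `p`: the UPPER half `ord_p #Ш(E) ≤ ord_p #Ш_an(E)`
over ONE reading of Wuthrich Thm. 16** — additive-p4's
`ClassX3.missingUpperBoundAt_rankZero_of_subSemistableTwist` with `{hWu}` ↦ ∅ (the (G-ord, `e = 2`)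
branch takes `charIdeal_dvd_padicLFunctionBranch_component_of_half hW16`). Named facts {Delbourgo 1998
Prop. 4 `hDel`, GZK, modularity `hmod` `hmodD`, Wuthrich Thm. 16 `hW16`}.
[cite: Delbourgo1998, Prop. 4 (p. 144)] [cite: Wuthrich2014, Thm. 16 (p. 397), Cor. 18 (p. 398)]
[cite: Miller2011LMS, Def. 1.1] -/
theorem ClassX3.missingUpperBoundAt_rankZero_of_subSemistableTwist_of_thm16
    (hDel : Delbourgo1998.prop4_rankZero_pow_dvd_constantCoeff)
    (hGZK : rank_eq_analyticRank_of_analyticRank_le_one) (hmod : hasEntireLFunction_rat)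
    (hmodD : nonempty_modularParametrizationData)
    (hW16 : Wuthrich2014.thm16_halfEigenCharIdeal_dvd_cyclotomicPrime)
    (hp2 : p ≠ 2) (hX : ClassX3 W p) (hr : W.analyticRank = 0) (hS : SubSemistableTwist W p) :
    MissingUpperBoundAt W p :=
  ClassX3.missingUpperBoundAt_rankZero_of_subSemistableTwist W p hDel hGZK hmod hmodD hW16
    (Wuthrich2014.charIdeal_dvd_padicLFunctionBranch_component_of_half hW16) hp2 hX hr hS

/-- **On X3 ∧ `r_an = 0` ∧ semistable twist the typed X3 input is EXACTLY the lower half**, every odd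
`p`, over ONE reading of Wuthrich Thm. 16 (`{hWu}` ↦ ∅ form of additive-p4's `…_iff_lower…`).
[cite: Delbourgo1998, Prop. 4 (p. 144)] [cite: Wuthrich2014, Thm. 16 (p. 397)] [cite: Miller2011LMS, Def. 1.1] -/
theorem ClassX3.missingPPartAt_iff_lower_rankZero_of_subSemistableTwist_of_thm16
    (hDel : Delbourgo1998.prop4_rankZero_pow_dvd_constantCoeff)
    (hGZK : rank_eq_analyticRank_of_analyticRank_le_one) (hmod : hasEntireLFunction_rat)
    (hmodD : nonempty_modularParametrizationData)
    (hW16 : Wuthrich2014.thm16_halfEigenCharIdeal_dvd_cyclotomicPrime)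
    (hp2 : p ≠ 2) (hX : ClassX3 W p) (hr : W.analyticRank = 0) (hS : SubSemistableTwist W p) :
    MissingPPartAt W p ↔ MissingLowerBoundAt W p :=
  ClassX3.missingPPartAt_iff_lower_rankZero_of_subSemistableTwist W p hDel hGZK hmod hmodD hW16
    (Wuthrich2014.charIdeal_dvd_padicLFunctionBranch_component_of_half hW16) hp2 hX hr hS

/-- **THE CHAIN OF RECORD FOR X3 ∧ `r = 0` ∧ semistable twist, every odd `p`: `BSD(E,p)` when
`#Ш_an(E)` is a `p`-unit, over ONE reading of Wuthrich Thm. 16** — `{hWu}` ↦ ∅ form of additive-p4's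
`ClassX3.bsdp_rankZero_of_subSemistableTwist_of_shaAn_unit` (r2 §II.23: the X3 @ 3 `W = 0` rows' road):
named facts 6 ↦ 5 = {hDel, hGZK, hmod, hmodD, hW16}; typed binders unchanged.
[cite: Delbourgo1998, Prop. 4 (p. 144)] [cite: Wuthrich2014, Thm. 16 (p. 397) and §3 (p. 390)]
[cite: Miller2011LMS, §1 and Def. 1.1] -/
theorem ClassX3.bsdp_rankZero_of_subSemistableTwist_of_shaAn_unit_of_thm16
    (hDel : Delbourgo1998.prop4_rankZero_pow_dvd_constantCoeff)
    (hGZK : rank_eq_analyticRank_of_analyticRank_le_one) (hmod : hasEntireLFunction_rat)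
    (hmodD : nonempty_modularParametrizationData)
    (hW16 : Wuthrich2014.thm16_halfEigenCharIdeal_dvd_cyclotomicPrime)
    (hp2 : p ≠ 2) (hX : ClassX3 W p) (hr : W.analyticRank = 0) (hS : SubSemistableTwist W p)
    {q : ℚ} (hq : shaAn W = (q : ℂ)) (hv : padicValRat p q = 0) : BSDp W p :=
  ClassX3.bsdp_rankZero_of_subSemistableTwist_of_shaAn_unit W p hDel hGZK hmod hmodD hW16
    (Wuthrich2014.charIdeal_dvd_padicLFunctionBranch_component_of_half hW16) hp2 hX hr hS hq hv

/-- **`BSD(E,p)` on X3 ∧ `r_an = 0` ∧ semistable twist from the LOWER half alone, over ONE reading of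
Wuthrich Thm. 16** — `{hWu}` ↦ ∅ form of additive-p4's `…_of_subSemistableTwist_of_lower`.
[cite: Delbourgo1998, Prop. 4 (p. 144)] [cite: Wuthrich2014, Thm. 16 (p. 397)] [cite: Miller2011LMS, §1 and Def. 1.1] -/
theorem ClassX3.bsdp_rankZero_of_subSemistableTwist_of_lower_of_thm16
    (hDel : Delbourgo1998.prop4_rankZero_pow_dvd_constantCoeff)
    (hGZK : rank_eq_analyticRank_of_analyticRank_le_one) (hmod : hasEntireLFunction_rat)
    (hmodD : nonempty_modularParametrizationData)
    (hW16 : Wuthrich2014.thm16_halfEigenCharIdeal_dvd_cyclotomicPrime)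
    (hp2 : p ≠ 2) (hX : ClassX3 W p) (hr : W.analyticRank = 0) (hS : SubSemistableTwist W p)
    (hlow : MissingLowerBoundAt W p) : BSDp W p :=
  ClassX3.bsdp_rankZero_of_subSemistableTwist_of_lower W p hDel hGZK hmod hmodD hW16
    (Wuthrich2014.charIdeal_dvd_padicLFunctionBranch_component_of_half hW16) hp2 hX hr hS hlow

/-- **X3 ∧ `r_an = 0` ∧ semistable twist: the LOWER residue closes per pair by a divisibility
certificate `p^{2k−1} ∣ #Ш(E/ℚ)`, over ONE reading of Wuthrich Thm. 16** — `{hWu}` ↦ ∅ form of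
additive-p4's `…_of_casselsTate_of_pow_dvd` (Cassels–Tate `hCT` for the lower half).
[cite: Delbourgo1998, Prop. 4 (p. 144)] [cite: Wuthrich2014, Thm. 16 (p. 397)]
[cite: SilvermanAEC2009, Thm. X.4.14] [cite: Miller2011LMS, §1 and Def. 1.1] -/
theorem ClassX3.bsdp_rankZero_of_subSemistableTwist_of_casselsTate_of_pow_dvd_of_thm16
    (hDel : Delbourgo1998.prop4_rankZero_pow_dvd_constantCoeff)
    (hGZK : rank_eq_analyticRank_of_analyticRank_le_one) (hmod : hasEntireLFunction_rat)
    (hmodD : nonempty_modularParametrizationData)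
    (hW16 : Wuthrich2014.thm16_halfEigenCharIdeal_dvd_cyclotomicPrime)
    (hCT : exists_casselsTate_pairing (K := ℚ))
    (hp2 : p ≠ 2) (hX : ClassX3 W p) (hr : W.analyticRank = 0) (hS : SubSemistableTwist W p)
    {q : ℚ} (hq : shaAn W = (q : ℂ)) {k : ℕ} (hv : padicValRat p q ≤ 2 * k)
    (hdvd : p ^ (2 * k - 1) ∣ W.shaOrder) : BSDp W p :=
  ClassX3.bsdp_rankZero_of_subSemistableTwist_of_casselsTate_of_pow_dvd W p hDel hGZK hmod hmodD hW16
    (Wuthrich2014.charIdeal_dvd_padicLFunctionBranch_component_of_half hW16) hCT hp2 hX hr hS hq hv hdvd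

/-- **X3 ∧ `r_an = 0` ∧ semistable twist, `ord_p #Ш_an ≤ 2`, `p ∤ #E(ℚ)_tors`: the LOWER residue
closes by the native line `Sel^(p)(E/ℚ) ≠ 0`, over ONE reading of Wuthrich Thm. 16** — `{hWu}` ↦ ∅
form of additive-p4's `…_of_casselsTate_of_selmerGroup_ne_bot` (r2 §II.23: the X3 @ 3 `W = 2` rows' END
of record): named facts 7 ↦ 6 = {hDel, hGZK, hmod, hmodD, hW16, hCT}; typed binders unchanged.
[cite: Delbourgo1998, Prop. 4 (p. 144)] [cite: Wuthrich2014, Thm. 16 (p. 397)]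
[cite: SilvermanAEC2009, Thm. X.4.2 and Thm. X.4.14] [cite: Miller2011LMS, §1 and Def. 1.1] -/
theorem ClassX3.bsdp_rankZero_of_subSemistableTwist_of_casselsTate_of_selmerGroup_ne_bot_of_thm16
    (hDel : Delbourgo1998.prop4_rankZero_pow_dvd_constantCoeff)
    (hGZK : rank_eq_analyticRank_of_analyticRank_le_one) (hmod : hasEntireLFunction_rat)
    (hmodD : nonempty_modularParametrizationData)
    (hW16 : Wuthrich2014.thm16_halfEigenCharIdeal_dvd_cyclotomicPrime)
    (hCT : exists_casselsTate_pairing (K := ℚ))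
    (hp2 : p ≠ 2) (hX : ClassX3 W p) (hr : W.analyticRank = 0) (hS : SubSemistableTwist W p)
    (htors : ¬ p ∣ W.torsionOrder)
    {q : ℚ} (hq : shaAn W = (q : ℂ)) (hv : padicValRat p q ≤ 2)
    (hSel : W.selmerGroup (p : ℤ) ≠ ⊥) : BSDp W p :=
  ClassX3.bsdp_rankZero_of_subSemistableTwist_of_casselsTate_of_selmerGroup_ne_bot W p hDel hGZK hmod
    hmodD hW16 (Wuthrich2014.charIdeal_dvd_padicLFunctionBranch_component_of_half hW16) hCT hp2 hX hr hS
    htors hq hv hSel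

end Residue

/-! ### §2 cc-typer-2's N10 class END and isogeny transports over `hW16` alone -/

section N10

variable (W : WeierstrassCurve ℚ) [W.IsElliptic] [W.IsGloballyMinimal] (p : ℕ) [hp : Fact p.Prime]

/-- **N10(X3) ⟹ `BSD(E,p)` on X3 ∧ `r_an = 0` ∧ semistable twist, every odd `p`, over ONE reading of
Wuthrich Thm. 16** — cc-typer-2's N10 CLASS END
`N10.bsdp_rankZero_classX3_of_lowerHalf_of_subSemistableTwist` with `{hWu}` ↦ ∅, NOTHING added: named
facts 6 ↦ 5 = {Delbourgo 1998 Prop. 4 `hDel`, GZK, modularity `hmod` `hmodD`, Wuthrich Thm. 16 `hW16`};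
the typed conjecture `h : N10.LowerHalf` and the row binders unchanged.
[cite: Delbourgo1998, Prop. 4 (p. 144)] [cite: Wuthrich2014, Thm. 16 (p. 397)] [cite: Miller2011LMS, §1 and Def. 1.1] -/
theorem N10.bsdp_rankZero_classX3_of_lowerHalf_of_subSemistableTwist_of_thm16 (h : N10.LowerHalf)
    (hDel : Delbourgo1998.prop4_rankZero_pow_dvd_constantCoeff)
    (hGZK : rank_eq_analyticRank_of_analyticRank_le_one) (hmod : hasEntireLFunction_rat)
    (hmodD : nonempty_modularParametrizationData)
    (hW16 : Wuthrich2014.thm16_halfEigenCharIdeal_dvd_cyclotomicPrime)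
    (hp2 : p ≠ 2) (hX : ClassX3 W p) (hr : W.analyticRank = 0) (hS : SubSemistableTwist W p) :
    BSDp W p :=
  N10.bsdp_rankZero_classX3_of_lowerHalf_of_subSemistableTwist W p h hDel hGZK hmod hmodD hW16
    (Wuthrich2014.charIdeal_dvd_padicLFunctionBranch_component_of_half hW16) hp2 hX hr hS

end N10

section Isogeny

variable {W W' : WeierstrassCurve ℚ} [W.IsElliptic] [W'.IsElliptic] [W.IsGloballyMinimal]
  [W'.IsGloballyMinimal] (p : ℕ) [hp : Fact p.Prime]

/-- **E3 isogeny transport on N10 ∩ X3: `BSD(E,p)` from ONE isogenous curve with `p ∤ #Ш_an`, over ONE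
reading of Wuthrich Thm. 16** — cc-typer-2's `N10.bsdp_rankZero_classX3_of_isIsogenous_shaAn_unit` with
`{hWu}` ↦ ∅ (7 ↦ 6 named, `hCassels` kept). Per pair; nothing booked.
[cite: Delbourgo1998, Prop. 4 (p. 144)] [cite: Wuthrich2014, Thm. 16 (p. 397)]
[cite: MilneADT2006, Thm. I.7.3] [cite: Miller2011LMS, §1 and Def. 1.1] -/
theorem N10.bsdp_rankZero_classX3_of_isIsogenous_shaAn_unit_of_thm16
    (hCassels : bsdRHS_eq_of_isIsogenous)
    (hDel : Delbourgo1998.prop4_rankZero_pow_dvd_constantCoeff)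
    (hGZK : rank_eq_analyticRank_of_analyticRank_le_one) (hmod : hasEntireLFunction_rat)
    (hmodD : nonempty_modularParametrizationData)
    (hW16 : Wuthrich2014.thm16_halfEigenCharIdeal_dvd_cyclotomicPrime)
    (hiso : IsIsogenous W W') (hp2 : p ≠ 2) (hX' : ClassX3 W' p) (hr' : W'.analyticRank = 0)
    (hS' : SubSemistableTwist W' p) {q' : ℚ} (hq' : shaAn W' = (q' : ℂ))
    (hv' : padicValRat p q' = 0) : BSDp W p :=
  N10.bsdp_rankZero_classX3_of_isIsogenous_shaAn_unit p hCassels hDel hGZK hmod hmodD hW16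
    (Wuthrich2014.charIdeal_dvd_padicLFunctionBranch_component_of_half hW16) hiso hp2 hX' hr' hS' hq' hv'

/-- The same transport read as the LOWER half at `(E, p)`, over ONE reading of Wuthrich Thm. 16 —
cc-typer-2's `N10.missingLowerBoundAt_rankZero_classX3_of_isIsogenous_shaAn_unit` with `{hWu}` ↦ ∅.
[cite: Delbourgo1998, Prop. 4 (p. 144)] [cite: Wuthrich2014, Thm. 16 (p. 397)] [cite: MilneADT2006, Thm. I.7.3] -/
theorem N10.missingLowerBoundAt_rankZero_classX3_of_isIsogenous_shaAn_unit_of_thm16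
    (hCassels : bsdRHS_eq_of_isIsogenous)
    (hDel : Delbourgo1998.prop4_rankZero_pow_dvd_constantCoeff)
    (hGZK : rank_eq_analyticRank_of_analyticRank_le_one) (hmod : hasEntireLFunction_rat)
    (hmodD : nonempty_modularParametrizationData)
    (hW16 : Wuthrich2014.thm16_halfEigenCharIdeal_dvd_cyclotomicPrime)
    (hiso : IsIsogenous W W') (hp2 : p ≠ 2) (hX' : ClassX3 W' p) (hr' : W'.analyticRank = 0)
    (hS' : SubSemistableTwist W' p) {q' : ℚ} (hq' : shaAn W' = (q' : ℂ))
    (hv' : padicValRat p q' = 0) : MissingLowerBoundAt W p :=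
  N10.missingLowerBoundAt_rankZero_classX3_of_isIsogenous_shaAn_unit p hCassels hDel hGZK hmod hmodD
    hW16 (Wuthrich2014.charIdeal_dvd_padicLFunctionBranch_component_of_half hW16) hiso hp2 hX' hr' hS'
    hq' hv'

end Isogeny

end Summit.BirchSwinnertonDyer.Rank1Residual.Additive

end
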